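import Summits.HodgeConjecture.HodgeConjecture.Theorems.MilnorKExponentialDefs
import Summits.HodgeConjecture.HodgeConjecture.Theorems.MilnorKExponentialSymbolClassesAlgebraicSymbolClassesHodgeType
import Summits.HodgeConjecture.HodgeConjecture.Theorems.LimitExtensionMiddleDivisorSupportSuffices
import Literature.AlgebraicGeometry.HodgeTheory.LefschetzOneOneHolds
import Literature.AlgebraicGeometry.HodgeTheory.GysinFormalismPushforward
import Literature.AlgebraicGeometry.HodgeTheory.SupportedHodgeClassesAlgebraic

/-!
# Stub (W₁) `NashSymbolConiveauOne` of the line `NashDescentSketch` — the slices the tree proves, and the reduction of the rest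

Support file for the crux `SymbolClassesAlgebraic` (stmt-HodgeConjecture-17743, route
`MilnorKExponential`), line `NashDescentSketch`, stub (W₁)
`NashSymbolConiveauOne` (`Theorems/MilnorKExponentialDefs`): every rational NASH symbol class of
weight `q + 1` on a smooth projective complex `n`-fold lies in
`N¹ H^{2q+2}(X(ℂ); ℂ) = supportedClasses X (2 * (q + 1)) 1`.

PROVED here (sorry-free, no definitions, no named facts):

* `mem_supportedClasses_one_of_restrictCompl_eq_zero'`,
  `exists_isClosed_ne_univ_of_mem_supportedClasses_one` — the coheight bookkeeping both ways: on a
  smooth projective (irreducible) `X`, a class lies in `N¹ Hⁱ` iff it dies on `(X ∖ Z)(ℂ)` for some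
  PROPER Zariski-closed `Z ⊊ X` (every point of a proper closed subset has codimension `≥ 1`; the
  generic point has codimension `0`);
* `nashSymbolConiveauOne_iff_dieOffClosed` — hence (W₁) is EQUIVALENT to "every rational Nash
  symbol class dies off a proper Zariski-closed subset", the form in which the idea card
  (`Cruxes/SymbolClassesAlgebraic/Ideas/nash-descent-weight-kill.md`, steps (G)+(W)) proves it;
* three unconditional slices, none of which uses the Nash refinement of the cocycle:
  `nashSymbolConiveauOne_weight_one` (`q = 0`: a rational symbol class is of Hodge type `(1,1)` by
  the landed stub (T) `stub_symbolClassesHodgeType`, hence a divisor class by Lefschetz `(1,1)`,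
  `lefschetzOneOne_rational_holds`, and `N¹ H² = algebraicClasses X 1` by definition);
  `nashSymbolConiveauOne_of_dim_lt` (`n < 2(q+1)`: every class of degree `> dim X` dies off a
  hypersurface section, Andreotti–Frankel, `mem_supportedClasses_one_of_dim_lt`);
  `nashSymbolConiveauOne_of_dim_le_three` (`n ≤ 3`: the Hodge conjecture in dimension `≤ 3`,
  `hodgeClasses_algebraic_of_dim_le_three_holds`, and `N^{q+1} ⊆ N¹`);
* `nashSymbolConiveauOne_of_band` — so (W₁) REDUCES to its band `4 ≤ n`, `1 ≤ q`, `2(q+1) ≤ n`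
  (first open case `(n, q + 1) = (4, 2)`), in the die-off-a-proper-closed-subset form;
* `nashSymbolConiveauOne_low_weights_of_weightTwoBand` — and what the line's composition actually
  consumes of (W₁), weights `1` and `2`, reduces to the WEIGHT-`2` BAND alone (`q = 1`, `n ≥ 4`).

NOT here (the residual, see the report `work/stubs/NashSymbolConiveauOne-report.md`): the band
itself, i.e. steps (G) (globalising the Nash units of the cocycle on a finite étale cover of the
complement of a divisor) and (W) (Deligne's weights on a smooth quasi-projective variety, cup
products of mixed Hodge structures, strictness) of the card — none of which has a carrier in the
tree today (`Motives.MixedHodgeStructureOfPair` has no weight bound for smooth open varieties and no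
cup product; its only inhabitant is the unproved named fact `existsDeligne`).

## References

* [DeligneHodgeII1971] P. Deligne, Théorie de Hodge II, Publ. Math. IHÉS 40 (1971), 3.2.15–17.
* [VoisinHodgeI2002] C. Voisin, Hodge Theory and Complex Algebraic Geometry I (2002), Thm. 11.30.
* [VoisinHodgeII2003] C. Voisin, Hodge Theory and Complex Algebraic Geometry II (2003), Thm. 1.22,
  §10.2.3 (proof of Prop. 10.26).
* [GrothendieckTopology1969] A. Grothendieck, Hodge's general conjecture is false for trivial
  reasons, Topology 8 (1969), §1.
-/

noncomputable section

open CategoryTheory AlgebraicGeometry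

-- `Summit.HodgeConjecture.HodgeConjecture.Theorems` is the mandated namespace (single-problem summit).
set_option linter.dupNamespace false

namespace Summit.HodgeConjecture.HodgeConjecture.Theorems.MilnorKExponentialNash

open Literature.AlgebraicGeometry Literature.AlgebraicGeometry.HodgeTheory
  Literature.AlgebraicGeometry.Motives

variable {n : ℕ} {X : SchemeOver ℂ}

/-! ### Coheight bookkeeping: `N¹ Hⁱ` = classes dying off a proper Zariski-closed subset -/

/-- **A class dying off a proper Zariski-closed subset of a smooth projective variety lies in
`N¹ Hⁱ`**: every point of a proper closed subset `Z ⊊ X` of the irreducible `X` has codimension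
`≥ 1` (`one_le_coheight_of_mem_of_isClosed`), so `ker (Hⁱ(X(ℂ)) → Hⁱ((X ∖ Z)(ℂ)))` is one of the
defining generators of `supportedClasses X i 1`. [cite: GrothendieckTopology1969, §1] -/
theorem mem_supportedClasses_one_of_restrictCompl_eq_zero' (hX : IsSmoothProjective n X) {i : ℕ}
    {Z : Set X.left} (hZ : IsClosed Z) (hZne : Z ≠ Set.univ) {c : complexBetti X i}
    (hc : complexBetti.restrictCompl X Z i c = 0) : c ∈ supportedClasses X i 1 :=
  mem_supportedClasses_of_restrictCompl_eq_zero hZ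
    (fun _ hz ↦ by exact_mod_cast one_le_coheight_of_mem_of_isClosed hX hZ hZne hz) hc

/-- **Conversely, a class of `N¹ Hⁱ` dies off ONE PROPER Zariski-closed subset**: it dies off a
closed `Z` all of whose points have codimension `≥ 1` (`exists_support_of_mem_supportedClasses`:
finite unions of supports are supports), and such a `Z` misses the generic point of the
irreducible `X` (codimension `0`), so `Z ≠ X`. [cite: GrothendieckTopology1969, §1] -/
theorem exists_isClosed_ne_univ_of_mem_supportedClasses_one (hX : IsSmoothProjective n X) {i : ℕ}
    {c : complexBetti X i} (hc : c ∈ supportedClasses X i 1) :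
    ∃ Z : Set X.left, IsClosed Z ∧ Z ≠ Set.univ ∧ complexBetti.restrictCompl X Z i c = 0 := by
  obtain ⟨Z, hZ, h1, h0⟩ := exists_support_of_mem_supportedClasses hc
  refine ⟨Z, hZ, fun hZu ↦ ?_, h0⟩
  haveI := irreducibleSpace_of_isSmoothProjective' hX
  have hη : Order.coheight (genericPoint X.left) = 0 :=
    Order.coheight_eq_zero.2 fun y _ ↦ Scheme.le_iff_specializes.2 (genericPoint_specializes y)
  have h := h1 (genericPoint X.left) (hZu ▸ Set.mem_univ _)
  rw [hη, Nat.cast_one] at h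
  exact absurd h (by decide)

/-! ### (W₁) ⟺ "rational Nash symbol classes die off a proper Zariski-closed subset" -/

/-- **(W₁) from its die-off form** (the shape in which the card proves it: the class dies on
`(X ∖ D)(ℂ)` for the branch-and-pole divisor `D` of the globalised Nash units). [folklore] -/
theorem nashSymbolConiveauOne_of_dieOffClosed
    (h : ∀ ⦃n : ℕ⦄ ⦃X : SchemeOver ℂ⦄, IsSmoothProjective n X →
      ∀ (q : ℕ) (c : complexBetti X (2 * (q + 1))), IsRationalClass c → IsNashSymbolClass n X q c →
        ∃ Z : Set X.left, IsClosed Z ∧ Z ≠ Set.univ ∧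
          complexBetti.restrictCompl X Z (2 * (q + 1)) c = 0) :
    NashSymbolConiveauOne := by
  intro n X hX q c hc hs
  obtain ⟨Z, hZ, hZne, h0⟩ := h hX q c hc hs
  exact mem_supportedClasses_one_of_restrictCompl_eq_zero' hX hZ hZne h0

/-- **The die-off form from (W₁)** (converse bookkeeping). [folklore] -/
theorem dieOffClosed_of_nashSymbolConiveauOne (h : NashSymbolConiveauOne) :
    ∀ ⦃n : ℕ⦄ ⦃X : SchemeOver ℂ⦄, IsSmoothProjective n X →
      ∀ (q : ℕ) (c : complexBetti X (2 * (q + 1))), IsRationalClass c → IsNashSymbolClass n X q c →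
        ∃ Z : Set X.left, IsClosed Z ∧ Z ≠ Set.univ ∧
          complexBetti.restrictCompl X Z (2 * (q + 1)) c = 0 :=
  fun _ _ hX q c hc hs ↦ exists_isClosed_ne_univ_of_mem_supportedClasses_one hX (h hX q c hc hs)

/-- **(W₁) ⟺ die-off form**: the stub is EQUIVALENT to "every rational Nash symbol class of weight
`q + 1` on a smooth projective complex variety vanishes on `(X ∖ Z)(ℂ)` for some proper
Zariski-closed `Z ⊊ X`". [folklore] -/
theorem nashSymbolConiveauOne_iff_dieOffClosed :
    NashSymbolConiveauOne ↔
      ∀ ⦃n : ℕ⦄ ⦃X : SchemeOver ℂ⦄, IsSmoothProjective n X →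
        ∀ (q : ℕ) (c : complexBetti X (2 * (q + 1))), IsRationalClass c →
          IsNashSymbolClass n X q c →
          ∃ Z : Set X.left, IsClosed Z ∧ Z ≠ Set.univ ∧
            complexBetti.restrictCompl X Z (2 * (q + 1)) c = 0 :=
  ⟨dieOffClosed_of_nashSymbolConiveauOne, nashSymbolConiveauOne_of_dieOffClosed⟩

/-! ### The unconditional slices -/

/-- **(W₁) in weight `1` (`q = 0`), unconditionally and without the Nash input**: a rational
(Nash) symbol class `c ∈ H²(X(ℂ); ℂ)` is of Hodge type `(1,1)` (stub (T),
`stub_symbolClassesHodgeType`), hence lies in `algebraicClasses X 1 = N¹ H²` by the Lefschetz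
theorem on `(1,1)`-classes (`lefschetzOneOne_rational_holds`).
[cite: VoisinHodgeI2002, Thm. 11.30, Cor. 11.34 and §11.3.3] -/
theorem nashSymbolConiveauOne_weight_one ⦃n : ℕ⦄ ⦃X : SchemeOver ℂ⦄ (hX : IsSmoothProjective n X)
    (c : complexBetti X (2 * (0 + 1))) (hc : IsRationalClass c) (hs : IsNashSymbolClass n X 0 c) :
    c ∈ supportedClasses X (2 * (0 + 1)) 1 :=
  lefschetzOneOne_rational_holds hX c hc (stub_symbolClassesHodgeType hX 0 c hc hs.isSymbolClass)

/-- **(W₁) above the dimension (`n < 2(q+1)`), unconditionally, for EVERY class**: a class of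
degree `> dim X` dies off a hypersurface section not containing `X` (its complement is smooth affine
of dimension `n`, without homology in that degree: Andreotti–Frankel), `mem_supportedClasses_one_of_dim_lt`.
[cite: VoisinHodgeII2003, §1.2.2 Thm. 1.22] -/
theorem nashSymbolConiveauOne_of_dim_lt ⦃n : ℕ⦄ ⦃X : SchemeOver ℂ⦄ (hX : IsSmoothProjective n X)
    {q : ℕ} (hq : n < 2 * (q + 1)) (c : complexBetti X (2 * (q + 1))) :
    c ∈ supportedClasses X (2 * (q + 1)) 1 :=
  mem_supportedClasses_one_of_dim_lt hX hq c

/-- **(W₁) in dimension `≤ 3`, unconditionally and without the Nash input**: a rational (Nash)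
symbol class of weight `q + 1` is a rational `(q+1, q+1)`-class (stub (T)), hence algebraic by the
Hodge conjecture for curves, surfaces and threefolds (`hodgeClasses_algebraic_of_dim_le_three_holds`:
Lefschetz `(1,1)` and hard Lefschetz), and `algebraicClasses X (q+1) = N^{q+1} ⊆ N¹`
(`supportedClasses_mono`). [cite: VoisinHodgeII2003, §10.2.3 proof of Prop. 10.26] -/
theorem nashSymbolConiveauOne_of_dim_le_three ⦃n : ℕ⦄ ⦃X : SchemeOver ℂ⦄ (hn : n ≤ 3)
    (hX : IsSmoothProjective n X) (q : ℕ) (c : complexBetti X (2 * (q + 1))) (hc : IsRationalClass c)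
    (hs : IsNashSymbolClass n X q c) : c ∈ supportedClasses X (2 * (q + 1)) 1 :=
  supportedClasses_mono X (2 * (q + 1)) (Nat.succ_le_succ (Nat.zero_le q))
    (hodgeClasses_algebraic_of_dim_le_three_holds hn hX (q + 1) c hc
      (stub_symbolClassesHodgeType hX q c hc hs.isSymbolClass))

/-- **(W₁) outside the band `4 ≤ n`, `1 ≤ q`, `2(q+1) ≤ n`** (the three slices assembled).
[cite: VoisinHodgeI2002, Thm. 11.30] [cite: VoisinHodgeII2003, Thm. 1.22 and §10.2.3] -/
theorem nashSymbolConiveauOne_outside_band ⦃n : ℕ⦄ ⦃X : SchemeOver ℂ⦄ (hX : IsSmoothProjective n X)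
    (q : ℕ) (hband : q = 0 ∨ n < 2 * (q + 1) ∨ n ≤ 3) (c : complexBetti X (2 * (q + 1)))
    (hc : IsRationalClass c) (hs : IsNashSymbolClass n X q c) :
    c ∈ supportedClasses X (2 * (q + 1)) 1 := by
  rcases hband with rfl | hlt | hle
  · exact nashSymbolConiveauOne_weight_one hX c hc hs
  · exact nashSymbolConiveauOne_of_dim_lt hX hlt c
  · exact nashSymbolConiveauOne_of_dim_le_three hle hX q c hc hs

/-! ### What the composition needs: weights `1` and `2` -/

/-- **(W₁) in weights `≤ 2` from its weight-`2` band alone.** In the composition of the line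
(`SymbolClassesAlgebraic_of`) the stub (W₁) is consumed only in weights `1` and `2` (weights `≥ 3`
are stub (W_alg, `≥ 3`)). Weight `1` is `nashSymbolConiveauOne_weight_one` and weight `2` in
dimension `n < 4` is `nashSymbolConiveauOne_of_dim_lt`; so all the composition needs beyond the
tree is the WEIGHT-`2` BAND: on a smooth projective complex `n`-fold with `n ≥ 4`, every rational
Nash symbol class `c ∈ H⁴(X(ℂ); ℂ)` of weight `2` dies on `(X ∖ Z)(ℂ)` for some proper
Zariski-closed `Z ⊊ X` (hypothesis `h`; first open case `n = 4`).
[cite: DeligneHodgeII1971, Cor. 3.2.15–3.2.17] -/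
theorem nashSymbolConiveauOne_low_weights_of_weightTwoBand
    (h : ∀ ⦃n : ℕ⦄ ⦃X : SchemeOver ℂ⦄, IsSmoothProjective n X → 4 ≤ n →
      ∀ (c : complexBetti X (2 * (1 + 1))), IsRationalClass c → IsNashSymbolClass n X 1 c →
        ∃ Z : Set X.left, IsClosed Z ∧ Z ≠ Set.univ ∧
          complexBetti.restrictCompl X Z (2 * (1 + 1)) c = 0)
    ⦃n : ℕ⦄ ⦃X : SchemeOver ℂ⦄ (hX : IsSmoothProjective n X) (q : ℕ) (hq : q ≤ 1)
    (c : complexBetti X (2 * (q + 1))) (hc : IsRationalClass c) (hs : IsNashSymbolClass n X q c) :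
    c ∈ supportedClasses X (2 * (q + 1)) 1 := by
  interval_cases q
  · exact nashSymbolConiveauOne_weight_one hX c hc hs
  · rcases Nat.lt_or_ge n 4 with hn | hn
    · exact nashSymbolConiveauOne_of_dim_lt hX (show n < 2 * (1 + 1) by omega) c
    · obtain ⟨Z, hZ, hZne, h0⟩ := h hX hn c hc hs
      exact mem_supportedClasses_one_of_restrictCompl_eq_zero' hX hZ hZne h0

/-! ### The residual: (W₁) reduces to its band, in die-off form -/

/-- **(W₁) from its band in die-off form.** If every rational Nash symbol class of weight
`q + 1 ≥ 2` on a smooth projective complex `n`-fold with `2(q+1) ≤ n` (so `n ≥ 4`) dies on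
`(X ∖ Z)(ℂ)` for some proper Zariski-closed `Z ⊊ X` — the content of steps (G) (globalise the Nash
units on a finite étale cover of `X ∖ D`) and (W) (Deligne's weights, Hodge II 3.2.15–17, and
strictness) of the card — then (W₁) holds: weights `≤ 2` are
`nashSymbolConiveauOne_low_weights_of_weightTwoBand` (fed with the case `q = 1` of the hypothesis),
the other cases outside the band are `nashSymbolConiveauOne_outside_band`.
[cite: DeligneHodgeII1971, Cor. 3.2.15–3.2.17] -/
theorem nashSymbolConiveauOne_of_band :
    (∀ ⦃n : ℕ⦄ ⦃X : SchemeOver ℂ⦄, IsSmoothProjective n X →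
      ∀ (q : ℕ), 1 ≤ q → 2 * (q + 1) ≤ n →
        ∀ (c : complexBetti X (2 * (q + 1))), IsRationalClass c → IsNashSymbolClass n X q c →
          ∃ Z : Set X.left, IsClosed Z ∧ Z ≠ Set.univ ∧
            complexBetti.restrictCompl X Z (2 * (q + 1)) c = 0) →
    NashSymbolConiveauOne := by
  intro h n X hX q c hc hs
  rcases Nat.lt_or_ge q 2 with hq2 | hq2
  · exact nashSymbolConiveauOne_low_weights_of_weightTwoBand
      (fun n X hX h4 c hc hs ↦ h hX 1 le_rfl (show 2 * (1 + 1) ≤ n by omega) c hc hs)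
      hX q (by omega) c hc hs
  · by_cases hband : q = 0 ∨ n < 2 * (q + 1) ∨ n ≤ 3
    · exact nashSymbolConiveauOne_outside_band hX q hband c hc hs
    · push Not at hband
      obtain ⟨-, hle, -⟩ := hband
      obtain ⟨Z, hZ, hZne, h0⟩ := h hX q (by omega) hle c hc hs
      exact mem_supportedClasses_one_of_restrictCompl_eq_zero' hX hZ hZne h0

end Summit.HodgeConjecture.HodgeConjecture.Theorems.MilnorKExponentialNash

end
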